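import Summits.NavierStokesRegularity.NavierStokesRegularity.Theorems.ExtremiserTransienceDepletedFractionCleanLockedWindow
import Summits.NavierStokesRegularity.NavierStokesRegularity.Theorems.ExtremiserTransienceDepletedFractionDefs
import Summits.NavierStokesRegularity.NavierStokesRegularity.Theses.ExtremiserTransience
import HarnessLib

/-!
# Crux `NearExtremalTransiencePerFlow` (stmt-NavierStokesRegularity-26567), LINE g13-β «relay» (ns-idea-5 g13)

NO SUMMIT IS PROVED BY A LINE.  Checked skeleton for the rank-2 crux of route `ExtremiserTransience`
(`closes hT hC hII hA : NavierStokesRegularity` consumes the crux as `hT`); bears on LADDER-NS rung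
«ExtremiserTransience / NearExtremalTransiencePerFlow ⟨26567⟩» only.  The heart D♭ below, the crux and NS regularity remain OPEN;
R♭ (relay obstruction) and W♭⁺ are PROVED in this file; the only `sorry` is the heart D♭.

## The mined example and the lever («has-beens keep their weight»)

Technique card «extremal-example mining», pointed at CROWDS (the residual enemy «unbounded cell multiplication» of every line on this
crux, g4 KEY RISK; heart C♭ of the sibling line g13-α `budget_cut`).  Mine the crowd examples: a superposition of far-apart admissible
cells `v = Σᵢ vᵢ` has stretching `J = Σᵢ Jᵢ`, `Z = Σ Zᵢ`, `P = Σ Pᵢ`, height `h = maxᵢ hᵢ`, and by Cauchy–Schwarz its depletion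
quotient obeys the CONVEXITY BOUND `q(v) ≤ Σᵢ λᵢ qᵢ`, `λᵢ = (hᵢ/h)·√(ZᵢPᵢ)/√(ZP)`, `Σᵢ λᵢ ≤ 1`.  Consequences read off the examples:
(1) a crowd of identical synchronised cells is exactly as efficient as one cell (`q_N = q₁`) — multiplicity alone never raises `q`;
(2) a crowd is `(κ⋆−ε)`-efficient at time `t'` only if the cells that are `(κ⋆−δ₀)`-efficient AT THAT TIME carry all but `ε/δ₀` of the
weight; (3) a cell PAST its efficient phase keeps its weight (its `Zᵢ, Pᵢ` change by bounded factors over `τ₁` turnovers under the window's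
gradient bound) and therefore DRAGS `q` down — near-extremality cannot be handed over like a baton.  Integrating (2) against (3):
if every cell is `(κ⋆−δ₀)`-efficient on at most an `η`-fraction of the window and weights persist up to a factor `Λ`, then the crowd is
`ε`-depleted on at least a `(1 − 2Λη)`-fraction of the window, for every `ε ≤ δ₀/2` — WHATEVER THE NUMBER OF CELLS.  This is the RELAY
OBSTRUCTION R♭ (pure measure theory on `[t, t+L]`, stated abstractly over weight/quotient families `w q : ℕ → ℝ → ℝ`).  It converts the
crowd-multiplicity problem into bookkeeping: under R♭ the only enemy left is a cell that is INDIVIDUALLY near-extremal for a long time —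
by compactness + the landed non-attainment theorems this cannot be a bounded-budget cell, so it must be an EXTENDED cell (tube / sheet /
packed array: the K1b class), now met as a TRANSIENCE question inside one violator rather than as a static non-existence question.

* **R♭ `RelayObstruction` (FLANK, abstract real analysis; PROVED in §1b, `relayObstruction_holds`).**  On a window `[a, a+L]`: weights `wᵢ ≥ 0` measurable with
  `Σᵢ wᵢ ≤ 1`, quotients `qᵢ ≤ κ` measurable, ONE-SIDED persistence `wᵢ(t') ≤ Λ wᵢ(a)` (no growth beyond a factor `Λ` relative to the window START; decay is free), individual transience `|{qᵢ > κ − δ₀}| ≤ ηL` for every `i`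
  ⇒ `|{Σᵢ wᵢqᵢ ≤ κ − ε}| ≥ εL` for `0 < ε ≤ min(δ₀/2, 1 − 2Λη)`.  Proof (§1b): on the bad set `Σ_{efficient i} wᵢ > (δ₀−ε)/δ₀ ≥ 1/2`;
  integrate, swap sum and integral (Tonelli), use persistence against `wᵢ(a)` and `Σ wᵢ(a) ≤ 1`: `|bad| ≤ 2ΛηL`.
* **D♭ `CellRelayDecomposition` (HEART, per violator, pinned, OPEN).**  In a violator, for every window package `(Θ, G, H, τ₁)` there are
  `δ₀ ∈ (0, κ⋆]`, `η ≥ 0`, `Λ ≥ 1` with `2Λη < 1` such that every PINNED admissible window (`M = C√ν/√(T−t)`, as in g13-α) carries a RELAY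
  DECOMPOSITION: measurable families `w q : ℕ → ℝ → ℝ` with the R♭ hypotheses for `κ = κ⋆` on `[t, t + τ₁ν/M²]` which DOMINATE the flow's
  depletion inequality: `|J(t')| ≤ (Σᵢ wᵢ(t') qᵢ(t'))·M'·√Z(t')·√P(t')` for every pointwise bound `M'` of `u(t')`.  Informally: the tall
  enstrophy of the window splits into dynamically individual cells (`wᵢ = ` normalised `√(ZᵢPᵢ)`-weights, `qᵢ = ` cell quotients `≤ κ⋆` by
  universality of `κ⋆` cell by cell), each individually transient, with weights that do not GROW by more than a factor `Λ` within the window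
  (rev 2: persistence is ONE-SIDED — the proof of R♭ only ever compares `wᵢ(t')` with `wᵢ` at the window START; decaying or dying cells cost nothing).
  Enemy list (honest): bounded-budget cells —
  individually transient by compactness + `slice_lt_sharp` / `MemberSelection.not_isExtremalSlice_of_typeIAncientMild` (the K♭ mechanism of
  `budget_cut`); far-apart cells — individual up to `O(R⁻⁴)` dipole strain; mesoscopic crowds (spacing `O(1)`: cross-stretching comparable to
  the margin) must be treated as ONE cell; EXTENDED cells (unbounded budget: tubes, sheets, packed arrays) — their individual transience is the
  open core (K1b class, g4 wall «no analytic extended extremiser», met dynamically).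
* **§PLAN-L1 — the D♭-plan's FIRST LEMMA, where the lever lives (critic P2, rev 2; recorded so a later seat can type it; NOT a decl of this file).**
  (L1, exact, typable now over `curl`/`fderiv`/`∫`) SUB-CONVEXITY FOR DISJOINTLY SUPPORTED CELLS: for `C¹` div-free fields `v₁ … v_N` on `ℝ³` with pairwise
  disjoint supports and `v = Σᵢ vᵢ`: `J(v) = Σᵢ J(vᵢ)`, `Z(v) = Σᵢ Zᵢ`, `P(v) = Σᵢ Pᵢ`, `sup‖v‖ = maxᵢ hᵢ` (all cross terms vanish pointwise), hence
  `q(v) := |J(v)|/(sup‖v‖·√Z·√P) ≤ Σᵢ λᵢ qᵢ`, `λᵢ := (hᵢ/maxⱼhⱼ)·√(ZᵢPᵢ)/√(ZP)`, `Σᵢ λᵢ ≤ Σᵢ √(ZᵢPᵢ)/√((ΣZⱼ)(ΣPⱼ)) ≤ 1` (Cauchy–Schwarz) — in words: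
  `N` synchronised copies of one cell have EXACTLY the quotient of one cell, and a crowd's quotient is a sub-convex combination of its cells' quotients.
  (L1′, with error term — the form a real (spatially analytic, never disjointly supported) flow needs) for a partition `v = Σᵢ (χᵢv − Bᵢ)` by a smooth
  partition of unity `χᵢ` at mutual distance `d` with Bogovskiĭ corrections `Bᵢ` (`div Bᵢ = ∇χᵢ·v`, supported in the overlap collars):
  `q(v) ≤ Σᵢ λᵢ qᵢ + E`, `E ≤ [Σ_{(i,j,k) not all equal} |∫⟨ωᵢ, ∇vⱼ ωₖ⟩| + collar terms] / (sup‖v‖·√Z·√P)`, where the cross-stretching of cells at finite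
  separation is `O((ρ/d)⁴)` relative for natural cells of size `ρ` (dipole strain decay `|∇vⱼ| ≲ hⱼρ⁴/d⁴` at distance `d` for a compactly budgeted
  div-free cell) and the collar terms are controlled by the `H¹ → L²`-bound of Bogovskiĭ's operator on the collars times the collar mass of `|ω|²`,
  `|∇ω|²`.  Mesoscopic crowds (`d ≍ ρ`: `E` comparable to the margin `δ₀`) must be treated as ONE cell — that is where the plan hands over to the
  individual-transience core.  THE HYPOTHESIS THE FALSIFIER ATTACKS is D♭'s ONE-SIDED persistence `wᵢ(t') ≤ Λ·wᵢ(t)` (rev 2; rev 1 had it two-sided,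
  unnecessarily): a cell BIRTH or fast reconnection moving `√(ZP)`-weight ONTO a cell by more than any fixed factor within `τ₁` natural turnovers.
* **Skeleton** (kernel-checked; ONE theorem concluding the crux BY NAME; sorries = 1 = the heart D♭): D♭ + R♭ ⇒ `PinnedDepletedFraction`
  (`pinnedDepletedFraction_of_relay`: `ε = min(δ₀/2, (1−2Λη)/2)`; R♭ on the window; `{Σwq ≤ κ⋆−ε} ⊆ DEPLETED_ε` by domination) ⇒ the crux by
  the g12-β measure sandwich through W♭⁺ `CleanLockedWindowAtScale` (PROVED here = landed p719836 proof + `rfl`, as in `budget_cut`).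

Levers of the listed lines in five words (20 incl. g13-α): see `Lines/budget_cut.lean`; g13-α = «pinned budget in cell units».  Lever here:
«has-beens keep their weight».  HONEST GRADE: a MECHANISM line — it removes one named enemy (multiplicity) from the heart by an elementary
obstruction and re-centres the heart on individual (extended-cell) transience; D♭ is a STRENGTHENING of the pinned heart that prescribes the
mechanism (strengthen-to-structure), so it may be false where the pinned heart is true (if near-extremal windows of a violator admit no cell
decomposition with non-growing weights — e.g. fast vortex reconnection or a cell BIRTH moving `√(ZP)`-weight onto a new cell within a turnover by
more than any fixed factor); that is its cheapest
falsifier.  Nearest relatives: `budget_cut` (sibling; its C♭ ⊇ the multiplicity enemy removed here), `multiscale_crowding` / `tight_or_chain` /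
`filament_*` (crowds via crowding-Liouville, chains, ledgers — none uses the convexity bound of the quotient in time), `dissipation_ledger`
(energy bookkeeping across epochs, not weight bookkeeping within a window).

INSTRUMENT ROW (design only; lineage kit CLOSED, KEY-NS #213/#217/#221/#222): RELAY — NS from `N` copies of the g11 record crystal at spacing
`d` with phases staggered by `jτ₁/N` (pre-evolved copies), measure the `ε`-depleted fraction of the pinned window vs `N`; prediction of the
line: fraction `≥ 1 − 2Λη` uniformly in `N` (no relay); a fraction `→ 0` with `N` would refute D♭'s persistence clause.

HONEST FRAMING: R♭ is elementary (and proved); D♭ is a conjecture about the cell structure of near-extremal windows inside a hypothetical Type-I violator;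
nothing about Navier–Stokes regularity or blow-up is proved here. [folklore]
-/


noncomputable section

open scoped Topology InnerProductSpace RealInnerProductSpace ENNReal ContDiff
open MeasureTheory Filter Set Metric
open Literature.Analysis.FluidPDE
open Summit.NavierStokesRegularity.NavierStokesRegularity.Theses.ExtremiserTransience
open Summit.NavierStokesRegularity.NavierStokesRegularity.Theorems
open Summit.NavierStokesRegularity.NavierStokesRegularity.Theorems.DepletionLadder.KStar.HalfSpace
open Summit.NavierStokesRegularity.NavierStokesRegularity.Theorems.NearExtremalTransiencePerFlow.ZoneTransversality
open Summit.NavierStokesRegularity.NavierStokesRegularity.Theorems.NearExtremalTransiencePerFlow.DepletedFraction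

namespace Summit.NavierStokesRegularity.NavierStokesRegularity.Cruxes.NearExtremalTransiencePerFlow.Relay

-- the summit's namespace repeats the problem name by convention (D-0017)
set_option linter.dupNamespace false
set_option linter.style.longLine false

/-! ## §1 The statements of the line -/

/-- **W♭⁺ — CLEAN LOCKED WINDOW AT THE TYPE-I SCALE (flow side; PROVED below, §3).**  The landed W♭ `CleanLockedWindow`
(`…DepletedFraction.cleanLockedWindow_holds`, p719836) with ONE extra conjunct exporting the SCALE PIN `M = C√ν/√(T−τ)` of its window
(the landed proof defines `M` so; the pin makes `M` comparable to the true height by Leray's lower rate, and `M·ν` the natural cell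
enstrophy).  A violator carries a coefficient `k` with the strict-efficiency read-back, constants `Θ, G, H, c_w > 0`, and for every level
`κ⋆/2 ≤ m < κ⋆`, every `η > 0`, every `0 < τ₁ ≤ c_w` ONE pinned packaged instant `τ` whose forward window is `η`-clean. -/
def CleanLockedWindowAtScale : Prop :=
  ∀ (C ν T : ℝ) (u : ℝ → EuclideanSpace ℝ (Fin 3) → EuclideanSpace ℝ (Fin 3)) (p : ℝ → EuclideanSpace ℝ (Fin 3) → ℝ),
    IsViolator C ν T u p →
    ∃ (k : ℝ → ℝ) (Θ G H c_w : ℝ),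
      (∀ t ∈ Set.Ico 0 T, ∀ m : ℝ, 0 ≤ m → m < k t → ∃ M : ℝ, (∀ x, ‖u t x‖ ≤ M) ∧
        m * M * Real.sqrt (∫ x, ‖curl (u t) x‖ ^ 2) * Real.sqrt (∫ x, frobeniusNormSq (fderiv ℝ (curl (u t)) x)) <
          |∫ x, ⟪curl (u t) x, fderiv ℝ (u t) x (curl (u t) x)⟫_ℝ|) ∧
      0 < Θ ∧ 0 < G ∧ 0 < H ∧ 0 < c_w ∧
      ∀ m : ℝ, kStar / 2 ≤ m → m < kStar → ∀ η : ℝ, 0 < η → ∀ τ₁ : ℝ, 0 < τ₁ → τ₁ ≤ c_w →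
        ∃ τ M : ℝ, 0 ≤ τ ∧ 0 < M ∧ τ + τ₁ * ν / M ^ 2 < T ∧ M = C * Real.sqrt ν / Real.sqrt (T - τ) ∧ (∀ x, ‖u τ x‖ ≤ M) ∧
          (∫ x, ‖curl (u τ) x‖ ^ 2) ≤ Θ * (ν / M) ^ 2 * (∫ x, frobeniusNormSq (fderiv ℝ (curl (u τ)) x)) ∧
          (∀ x, ‖fderiv ℝ (u τ) x‖ ≤ G * M ^ 2 / ν) ∧
          (∀ t' ∈ Set.Icc τ (τ + τ₁ * ν / M ^ 2), ∀ x, ‖u t' x‖ ≤ H * M) ∧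
          volume ({σ : ℝ | k σ ≤ m} ∩ Set.Icc τ (τ + τ₁ * ν / M ^ 2)) ≤ ENNReal.ofReal (η * (τ₁ * ν / M ^ 2))

/-- **R♭ — RELAY OBSTRUCTION (FLANK; abstract real analysis on a window; PROVED below, `relayObstruction_holds`, §1b).**  Weights `wᵢ ≥ 0` (measurable,
`Σᵢ wᵢ ≤ 1` on the window), quotients `qᵢ ≤ κ` (measurable), ONE-SIDED persistence `wᵢ(t') ≤ Λ·wᵢ(a)` against the window start (growth bounded, decay free) on the window, individual transience
`|{qᵢ > κ − δ₀} ∩ I| ≤ ηL` for every `i` ⇒ the convex combination `Σᵢ wᵢqᵢ` is `≤ κ − ε` on a set of measure `≥ εL`, for every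
`0 < ε ≤ min(δ₀/2, 1 − 2Λη)`.  («Has-beens keep their weight»: no relay of near-extremality among individually transient cells.) -/
def RelayObstruction : Prop :=
  ∀ (κ δ₀ η Λ ε a L : ℝ), 0 < δ₀ → δ₀ ≤ κ → 0 ≤ η → 1 ≤ Λ → 0 < ε → ε ≤ δ₀ / 2 → ε ≤ 1 - 2 * Λ * η → 0 < L →
  ∀ (w q : ℕ → ℝ → ℝ),
    (∀ i, Measurable (w i)) → (∀ i, Measurable (q i)) →
    (∀ i t', 0 ≤ w i t') →
    (∀ t' ∈ Set.Icc a (a + L), Summable (fun i => w i t') ∧ ∑' i, w i t' ≤ 1) →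
    (∀ i, ∀ t' ∈ Set.Icc a (a + L), q i t' ≤ κ) →
    (∀ i, ∀ t' ∈ Set.Icc a (a + L), w i t' ≤ Λ * w i a) →
    (∀ i, volume ({t' : ℝ | κ - δ₀ < q i t'} ∩ Set.Icc a (a + L)) ≤ ENNReal.ofReal (η * L)) →
    ENNReal.ofReal (ε * L) ≤ volume ({t' : ℝ | ∑' i, w i t' * q i t' ≤ κ - ε} ∩ Set.Icc a (a + L))

/-- **D♭ — CELL RELAY DECOMPOSITION (HEART, per violator, pinned, OPEN).**  In a violator flow, for every window package `(Θ, G, H, τ₁)`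
there are `δ₀ ∈ (0, κ⋆]`, `η ≥ 0`, `Λ ≥ 1` with `2Λη < 1` such that every PINNED admissible window (`M = C√ν/√(T−t)`, lock, gradient,
heights — the g13-α package) carries measurable weight/quotient families `w q : ℕ → ℝ → ℝ` on `I = [t, t + τ₁ν/M²]` with: `wᵢ ≥ 0`,
`Σᵢ wᵢ ≤ 1`, `qᵢ ≤ κ⋆`, ONE-SIDED persistence `wᵢ(t') ≤ Λ wᵢ(t)` (no weight GROWS beyond a factor `Λ` relative to the window START `t`; decay, death and
merging-losers are free — rev 2), individual transience `|{qᵢ > κ⋆ − δ₀} ∩ I| ≤ η|I|`, and DOMINATION of the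
flow's depletion inequality: `|J(t')| ≤ (Σᵢ wᵢ(t')qᵢ(t'))·M'·√Z(t')·√P(t')` for every pointwise bound `M'` of `u(t')`, `t' ∈ I`.

LABEL (critic idea-crit-4 P1, rev 2): **D♭ = STRONG PINNED DEPLETION, CELL-LICENSED.**  The families `(w, q)` are an EXISTENTIAL LICENCE, not
geometric cells: the ONE-CELL instance `w₀ ≡ 1`, `q₀ =` the flow's own quotient `|J|/(sup‖u‖·√Z·√P) ≤ κ⋆` (persistence trivial, `Λ = 1`) shows
`StrongPinnedDepletion (fixed δ₀; efficient fraction ≤ η < 1/(2Λ) on every pinned window) ⇒ D♭ ⇒ (R♭) PinnedDepletedFraction`, so D♭ as typed is a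
statement about the distribution of the flow's quotient on pinned windows, sandwiched between strong and weak pinned depletion; the crowd content
(«multiplicity is free») lives in R♭ (proved) and in the D♭-PLAN's first lemma (sub-convexity, module docstring §PLAN-L1). -/
def CellRelayDecomposition : Prop :=
  ∀ (C ν T : ℝ) (u : ℝ → EuclideanSpace ℝ (Fin 3) → EuclideanSpace ℝ (Fin 3)) (p : ℝ → EuclideanSpace ℝ (Fin 3) → ℝ),
    IsViolator C ν T u p →
    ∀ (Θ G H τ₁ : ℝ), 0 < Θ → 0 < G → 0 < H → 0 < τ₁ →
    ∃ δ₀ η Λ : ℝ, 0 < δ₀ ∧ δ₀ ≤ kStar ∧ 0 ≤ η ∧ 1 ≤ Λ ∧ 2 * Λ * η < 1 ∧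
    ∀ (t M : ℝ), 0 ≤ t → 0 < M → t + τ₁ * ν / M ^ 2 < T → M = C * Real.sqrt ν / Real.sqrt (T - t) →
      (∀ x, ‖u t x‖ ≤ M) →
      (∫ x, ‖curl (u t) x‖ ^ 2) ≤ Θ * (ν / M) ^ 2 * (∫ x, frobeniusNormSq (fderiv ℝ (curl (u t)) x)) →
      (∀ x, ‖fderiv ℝ (u t) x‖ ≤ G * M ^ 2 / ν) →
      (∀ t' ∈ Set.Icc t (t + τ₁ * ν / M ^ 2), ∀ x, ‖u t' x‖ ≤ H * M) →
      ∃ (w q : ℕ → ℝ → ℝ),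
        (∀ i, Measurable (w i)) ∧ (∀ i, Measurable (q i)) ∧
        (∀ i t', 0 ≤ w i t') ∧
        (∀ t' ∈ Set.Icc t (t + τ₁ * ν / M ^ 2), Summable (fun i => w i t') ∧ ∑' i, w i t' ≤ 1) ∧
        (∀ i, ∀ t' ∈ Set.Icc t (t + τ₁ * ν / M ^ 2), q i t' ≤ kStar) ∧
        (∀ i, ∀ t' ∈ Set.Icc t (t + τ₁ * ν / M ^ 2), w i t' ≤ Λ * w i t) ∧
        (∀ i, volume ({t' : ℝ | kStar - δ₀ < q i t'} ∩ Set.Icc t (t + τ₁ * ν / M ^ 2)) ≤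
          ENNReal.ofReal (η * (τ₁ * ν / M ^ 2))) ∧
        (∀ t' ∈ Set.Icc t (t + τ₁ * ν / M ^ 2), ∀ M' : ℝ, (∀ x, ‖u t' x‖ ≤ M') →
          |∫ x, ⟪curl (u t') x, fderiv ℝ (u t') x (curl (u t') x)⟫_ℝ| ≤
            (∑' i, w i t' * q i t') * M' * Real.sqrt (∫ x, ‖curl (u t') x‖ ^ 2) *
              Real.sqrt (∫ x, frobeniusNormSq (fderiv ℝ (curl (u t')) x)))

/-- **X♭ per violator at pinned windows** (the REPAIRED heart of g13-α `budget_cut`, VERBATIM: `ε` may depend on the violator, `M` is the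
Type-I envelope; here D♭ + R♭ imply THIS, and THIS is what the sandwich consumes). -/
def PinnedDepletedFraction : Prop :=
  ∀ (C ν T : ℝ) (u : ℝ → EuclideanSpace ℝ (Fin 3) → EuclideanSpace ℝ (Fin 3)) (p : ℝ → EuclideanSpace ℝ (Fin 3) → ℝ),
    IsViolator C ν T u p →
    ∀ (Θ G H τ₁ : ℝ), 0 < Θ → 0 < G → 0 < H → 0 < τ₁ → ∃ ε : ℝ, 0 < ε ∧
    ∀ (t M : ℝ), 0 ≤ t → 0 < M → t + τ₁ * ν / M ^ 2 < T → M = C * Real.sqrt ν / Real.sqrt (T - t) →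
      (∀ x, ‖u t x‖ ≤ M) →
      (∫ x, ‖curl (u t) x‖ ^ 2) ≤ Θ * (ν / M) ^ 2 * (∫ x, frobeniusNormSq (fderiv ℝ (curl (u t)) x)) →
      (∀ x, ‖fderiv ℝ (u t) x‖ ≤ G * M ^ 2 / ν) →
      (∀ t' ∈ Set.Icc t (t + τ₁ * ν / M ^ 2), ∀ x, ‖u t' x‖ ≤ H * M) →
      ENNReal.ofReal (ε * (τ₁ * ν / M ^ 2)) ≤
        volume ({t' : ℝ | ∀ M' : ℝ, (∀ x, ‖u t' x‖ ≤ M') →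
            |∫ x, ⟪curl (u t') x, fderiv ℝ (u t') x (curl (u t') x)⟫_ℝ| ≤
              (kStar - ε) * M' * Real.sqrt (∫ x, ‖curl (u t') x‖ ^ 2) *
                Real.sqrt (∫ x, frobeniusNormSq (fderiv ℝ (curl (u t')) x))} ∩
          Set.Icc t (t + τ₁ * ν / M ^ 2))


/-! ## §1b R♭ PROVED (rev 1 of this workfile; Mathlib only: Tonelli for `tsum`, persistence against the left endpoint, complement in the window) -/

/-- **R♭ holds.**  On the bad set the currently-efficient cells carry weight `≥ 1/2` (pointwise `wᵢqᵢ ≤ (κ−δ₀)wᵢ + δ₀wᵢ𝟙_{Eᵢ}`, `Σwᵢ ≤ 1`,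
`ε ≤ δ₀/2`); integrate `G_i = 𝟙_{E_i}·2wᵢ` over the window, swap `∑'` and `∫⁻` (`lintegral_tsum`), bound each cell by persistence against `wᵢ(a)` and
its individual transience, sum `Σ wᵢ(a) ≤ 1`: the measurable bad set has measure `≤ 2ΛηL`; take the complement inside `[a, a+L]`. [folklore] -/
theorem relayObstruction_holds : RelayObstruction := by
  intro κ δ₀ η Λ ε a L hδ₀ hδκ hη hΛ hε hε1 hε2 hL w q hwm hqm hw0 hsum hqle hpers htrans
  set I : Set ℝ := Icc a (a + L) with hI
  have haI : a ∈ I := ⟨le_rfl, by linarith⟩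
  have hIm : MeasurableSet I := measurableSet_Icc
  have hΛ0 : 0 ≤ Λ := by linarith
  -- efficient sets of the cells
  set E : ℕ → Set ℝ := fun i => {t' | κ - δ₀ < q i t'} with hE
  have hEm : ∀ i, MeasurableSet (E i) := fun i => measurableSet_lt measurable_const (hqm i)
  -- G i := 𝟙_{E i} · ofReal (2 w i)
  set G : ℕ → ℝ → ℝ≥0∞ := fun i => (E i).indicator (fun t' => ENNReal.ofReal (2 * w i t')) with hG
  have hGm : ∀ i, Measurable (G i) := fun i =>
    (ENNReal.measurable_ofReal.comp ((hwm i).const_mul 2)).indicator (hEm i)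
  have hGsm : Measurable (fun t' => ∑' i, G i t') := Measurable.tsum hGm
  -- the measurable bad set B' ⊇ the bad set
  set B' : Set ℝ := {t' | 1 ≤ ∑' i, G i t'} ∩ I with hB'
  have hB'm : MeasurableSet B' := (hGsm measurableSet_Ici).inter hIm
  have hB'sub : B' ⊆ I := inter_subset_right
  ------------------------------------------------------------------
  -- Step A: a bad time (crowd efficient) has currently-efficient weight ≥ 1/2, i.e. Σ' G ≥ 1
  ------------------------------------------------------------------
  have hptw : ∀ t' ∈ I, κ - ε < ∑' i, w i t' * q i t' → 1 ≤ ∑' i, G i t' := by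
    intro t' ht'I hbad
    have hws : Summable (fun i => w i t') := (hsum t' ht'I).1
    have hw1 : ∑' i, w i t' ≤ 1 := (hsum t' ht'I).2
    have hpos : 0 < ∑' i, w i t' * q i t' := by
      have : 0 < κ - ε := by linarith
      linarith
    have hwqs : Summable (fun i => w i t' * q i t') := by
      by_contra h
      rw [tsum_eq_zero_of_not_summable h] at hpos
      exact lt_irrefl _ hpos
    set g : ℕ → ℝ := fun i => (E i).indicator (fun s => w i s) t' with hg
    have hg_mem : ∀ i, t' ∈ E i → g i = w i t' := fun i hi => by simp [hg, Set.indicator_of_mem hi]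
    have hg_nmem : ∀ i, t' ∉ E i → g i = 0 := fun i hi => by simp [hg, Set.indicator_of_notMem hi]
    have hg0 : ∀ i, 0 ≤ g i := by
      intro i; by_cases hi : t' ∈ E i
      · rw [hg_mem i hi]; exact hw0 i t'
      · rw [hg_nmem i hi]
    have hgle : ∀ i, g i ≤ w i t' := by
      intro i; by_cases hi : t' ∈ E i
      · rw [hg_mem i hi]
      · rw [hg_nmem i hi]; exact hw0 i t'
    have hgs : Summable g := Summable.of_nonneg_of_le hg0 hgle hws
    have hpt : ∀ i, w i t' * q i t' ≤ (κ - δ₀) * w i t' + δ₀ * g i := by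
      intro i
      by_cases hi : t' ∈ E i
      · rw [hg_mem i hi]
        have := hqle i t' ht'I
        nlinarith [hw0 i t']
      · rw [hg_nmem i hi]
        have hqi : q i t' ≤ κ - δ₀ := not_lt.mp hi
        nlinarith [hw0 i t']
    have htsum_le : ∑' i, w i t' * q i t' ≤ (κ - δ₀) * ∑' i, w i t' + δ₀ * ∑' i, g i := by
      have h1 : ∑' i, w i t' * q i t' ≤ ∑' i, ((κ - δ₀) * w i t' + δ₀ * g i) :=
        hwqs.tsum_le_tsum hpt ((hws.mul_left _).add (hgs.mul_left _))
      have h2 : ∑' i, ((κ - δ₀) * w i t' + δ₀ * g i) = (κ - δ₀) * ∑' i, w i t' + δ₀ * ∑' i, g i := by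
        rw [(hws.mul_left _).tsum_add (hgs.mul_left _), tsum_mul_left, tsum_mul_left]
      linarith
    have hκδ : 0 ≤ κ - δ₀ := by linarith
    have hS : (κ - δ₀) * ∑' i, w i t' ≤ κ - δ₀ := by nlinarith
    have hhalf : (1:ℝ) / 2 ≤ ∑' i, g i := by
      by_contra hc
      have hc' : ∑' i, g i < 1 / 2 := not_le.mp hc
      have : δ₀ * ∑' i, g i ≤ δ₀ * (1 / 2) := mul_le_mul_of_nonneg_left hc'.le hδ₀.le
      linarith
    have h2g : (1:ℝ) ≤ ∑' i, 2 * g i := by rw [tsum_mul_left]; linarith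
    have hGeq : ∀ i, G i t' = ENNReal.ofReal (2 * g i) := by
      intro i
      by_cases hi : t' ∈ E i
      · simp [hG, Set.indicator_of_mem hi, hg_mem i hi]
      · simp [hG, Set.indicator_of_notMem hi, hg_nmem i hi]
    have h2g0 : ∀ i, 0 ≤ 2 * g i := fun i => by linarith [hg0 i]
    calc (1 : ℝ≥0∞) = ENNReal.ofReal 1 := ENNReal.ofReal_one.symm
      _ ≤ ENNReal.ofReal (∑' i, 2 * g i) := ENNReal.ofReal_le_ofReal h2g
      _ = ∑' i, ENNReal.ofReal (2 * g i) := ENNReal.ofReal_tsum_of_nonneg h2g0 (hgs.mul_left 2)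
      _ = ∑' i, G i t' := tsum_congr fun i => (hGeq i).symm
  ------------------------------------------------------------------
  -- Step B: per-cell integral bound by persistence and individual transience
  ------------------------------------------------------------------
  have hcell : ∀ i, ∫⁻ t' in I, G i t' ≤ ENNReal.ofReal (2 * Λ * w i a) * ENNReal.ofReal (η * L) := by
    intro i
    have hle : ∀ t' ∈ I, G i t' ≤ (E i).indicator (fun _ => ENNReal.ofReal (2 * Λ * w i a)) t' := by
      intro t' ht'
      by_cases hi : t' ∈ E i
      · simp only [hG, Set.indicator_of_mem hi]
        refine ENNReal.ofReal_le_ofReal ?_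
        have := hpers i t' ht'
        nlinarith
      · simp [hG, Set.indicator_of_notMem hi]
    calc ∫⁻ t' in I, G i t' ≤ ∫⁻ t' in I, (E i).indicator (fun _ => ENNReal.ofReal (2 * Λ * w i a)) t' :=
          setLIntegral_mono' hIm hle
      _ = ENNReal.ofReal (2 * Λ * w i a) * volume (E i ∩ I) := by
          rw [lintegral_indicator_const (hEm i), Measure.restrict_apply (hEm i)]
      _ ≤ ENNReal.ofReal (2 * Λ * w i a) * ENNReal.ofReal (η * L) := by
          gcongr
          exact htrans i
  ------------------------------------------------------------------
  -- Step C: the measurable bad set is small: volume B' ≤ ofReal (2Λη L)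
  ------------------------------------------------------------------
  have hwsa : Summable (fun i => w i a) := (hsum a haI).1
  have hw1a : ∑' i, w i a ≤ 1 := (hsum a haI).2
  have hB'small : volume B' ≤ ENNReal.ofReal (2 * Λ * η * L) := by
    have h1 : volume B' = ∫⁻ t' in B', (1 : ℝ≥0∞) := (setLIntegral_one B').symm
    have h2 : ∫⁻ t' in B', (1 : ℝ≥0∞) ≤ ∫⁻ t' in B', ∑' i, G i t' :=
      setLIntegral_mono' hB'm fun t' ht' => ht'.1
    have h3 : ∫⁻ t' in B', ∑' i, G i t' ≤ ∫⁻ t' in I, ∑' i, G i t' := lintegral_mono_set hB'sub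
    have h4 : ∫⁻ t' in I, ∑' i, G i t' = ∑' i, ∫⁻ t' in I, G i t' :=
      lintegral_tsum fun i => (hGm i).aemeasurable
    have h5 : ∑' i, ∫⁻ t' in I, G i t' ≤ ∑' i, ENNReal.ofReal (2 * Λ * w i a) * ENNReal.ofReal (η * L) :=
      ENNReal.tsum_le_tsum hcell
    have h6 : ∑' i, ENNReal.ofReal (2 * Λ * w i a) * ENNReal.ofReal (η * L)
        = ENNReal.ofReal (2 * Λ) * (∑' i, ENNReal.ofReal (w i a)) * ENNReal.ofReal (η * L) := by
      rw [ENNReal.tsum_mul_right, ← ENNReal.tsum_mul_left]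
      congr 1
      refine tsum_congr fun i => ?_
      rw [← ENNReal.ofReal_mul (by positivity), mul_assoc]
    have h7 : ∑' i, ENNReal.ofReal (w i a) = ENNReal.ofReal (∑' i, w i a) :=
      (ENNReal.ofReal_tsum_of_nonneg (fun i => hw0 i a) hwsa).symm
    have h8 : ENNReal.ofReal (∑' i, w i a) ≤ 1 := by
      rw [← ENNReal.ofReal_one]; exact ENNReal.ofReal_le_ofReal hw1a
    calc volume B' = ∫⁻ t' in B', (1 : ℝ≥0∞) := h1
      _ ≤ ∑' i, ENNReal.ofReal (2 * Λ * w i a) * ENNReal.ofReal (η * L) := (h2.trans h3).trans (h4.le.trans h5)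
      _ = ENNReal.ofReal (2 * Λ) * (∑' i, ENNReal.ofReal (w i a)) * ENNReal.ofReal (η * L) := h6
      _ ≤ ENNReal.ofReal (2 * Λ) * 1 * ENNReal.ofReal (η * L) := by rw [h7]; gcongr
      _ = ENNReal.ofReal (2 * Λ * η * L) := by
          rw [mul_one, ← ENNReal.ofReal_mul (by positivity)]; ring_nf
  ------------------------------------------------------------------
  -- Step D: complement inside the window
  ------------------------------------------------------------------
  have hgood : I \ B' ⊆ {t' : ℝ | ∑' i, w i t' * q i t' ≤ κ - ε} ∩ I := by
    intro t' ht'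
    refine ⟨?_, ht'.1⟩
    by_contra hc
    exact ht'.2 ⟨hptw t' ht'.1 (not_le.mp hc), ht'.1⟩
  have hvolI : volume I = ENNReal.ofReal L := by
    rw [hI, Real.volume_Icc]; ring_nf
  have hB'fin : volume B' ≠ (⊤ : ℝ≥0∞) := ((measure_mono hB'sub).trans_lt (by rw [hvolI]; exact ENNReal.ofReal_lt_top)).ne
  have hdiff : volume (I \ B') = volume I - volume B' := measure_sdiff hB'sub hB'm.nullMeasurableSet hB'fin
  have h2ΛηL : 0 ≤ 2 * Λ * η * L := by positivity
  calc ENNReal.ofReal (ε * L) ≤ ENNReal.ofReal (L - 2 * Λ * η * L) := by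
        refine ENNReal.ofReal_le_ofReal ?_; nlinarith
    _ = ENNReal.ofReal L - ENNReal.ofReal (2 * Λ * η * L) := ENNReal.ofReal_sub _ h2ΛηL
    _ ≤ volume I - volume B' := by rw [hvolI]; exact tsub_le_tsub_left hB'small _
    _ = volume (I \ B') := hdiff.symm
    _ ≤ _ := measure_mono hgood

/-! ## §2 Registered stub names (the ONLY `sorry` of the file is the HEART D♭; R♭ is closed in §1b) -/

/-- FLANK — CLOSED in-file at rev 1 (`relayObstruction_holds`, §1b); kept under the stub name so the composition's hypothesis list is stable. -/
theorem stub_relayObstruction : RelayObstruction :=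
  relayObstruction_holds

/-- HEART (open): near-extremal pinned windows of a violator carry a relay decomposition. -/
theorem stub_cellRelayDecomposition : CellRelayDecomposition := by
  sorry

namespace Registered
/-- registered name of R♭ (closed: `relayObstruction_holds`) -/
abbrev stub_relayObstruction : Prop := RelayObstruction
/-- registered name of D♭ -/
abbrev stub_cellRelayDecomposition : Prop := CellRelayDecomposition
end Registered

/-! ## §3 The relay cut: D♭ + R♭ ⇒ pinned X♭ per violator (domination + the abstract obstruction; no analysis) -/

/-- **D♭ + R♭ ⇒ pinned X♭.**  `ε = min(δ₀/2, (1 − 2Λη)/2)`; at a pinned window take D♭'s families, apply R♭ on `[t, t + τ₁ν/M²]`,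
and note `{Σwq ≤ κ⋆ − ε} ∩ I ⊆ DEPLETED_ε ∩ I` by domination (the factor `M'√Z√P` is non-negative). [folklore] -/
theorem pinnedDepletedFraction_of_relay (hR : RelayObstruction) (hD : CellRelayDecomposition) :
    PinnedDepletedFraction := by
  intro C ν T u p hV Θ G H τ₁ hΘ hG hH hτ₁
  have hν : 0 < ν := hV.2.1
  obtain ⟨δ₀, η, Λ, hδ₀, hδ₀κ, hη, hΛ, hΛη, hwin⟩ := hD C ν T u p hV Θ G H τ₁ hΘ hG hH hτ₁
  set ε : ℝ := min (δ₀ / 2) ((1 - 2 * Λ * η) / 2) with hεdef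
  have hε : 0 < ε := lt_min (by linarith) (by linarith)
  have hε1 : ε ≤ δ₀ / 2 := min_le_left _ _
  have hε2 : ε ≤ 1 - 2 * Λ * η := (min_le_right _ _).trans (by linarith)
  refine ⟨ε, hε, ?_⟩
  intro t M ht hM htT hpin hMb hlock hgrad hheights
  have hL : 0 < τ₁ * ν / M ^ 2 := by positivity
  obtain ⟨w, q, hwm, hqm, hw0, hsum, hqle, hpers, htrans, hdom⟩ :=
    hwin t M ht hM htT hpin hMb hlock hgrad hheights
  have hRB := hR kStar δ₀ η Λ ε t (τ₁ * ν / M ^ 2) hδ₀ hδ₀κ hη hΛ hε hε1 hε2 hL w q hwm hqm hw0 hsum hqle hpers htrans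
  refine hRB.trans (measure_mono ?_)
  rintro t' ⟨hle, ht'I⟩
  refine ⟨fun M' hM' => ?_, ht'I⟩
  have hM'0 : 0 ≤ M' := (norm_nonneg _).trans (hM' 0)
  have hfac : 0 ≤ M' * Real.sqrt (∫ x, ‖curl (u t') x‖ ^ 2) *
      Real.sqrt (∫ x, frobeniusNormSq (fderiv ℝ (curl (u t')) x)) := by positivity
  calc |∫ x, ⟪curl (u t') x, fderiv ℝ (u t') x (curl (u t') x)⟫_ℝ|
      ≤ (∑' i, w i t' * q i t') * M' * Real.sqrt (∫ x, ‖curl (u t') x‖ ^ 2) *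
          Real.sqrt (∫ x, frobeniusNormSq (fderiv ℝ (curl (u t')) x)) := hdom t' ht'I M' hM'
    _ = (∑' i, w i t' * q i t') * (M' * Real.sqrt (∫ x, ‖curl (u t') x‖ ^ 2) *
          Real.sqrt (∫ x, frobeniusNormSq (fderiv ℝ (curl (u t')) x))) := by ring
    _ ≤ (kStar - ε) * (M' * Real.sqrt (∫ x, ‖curl (u t') x‖ ^ 2) *
          Real.sqrt (∫ x, frobeniusNormSq (fderiv ℝ (curl (u t')) x))) := mul_le_mul_of_nonneg_right hle hfac
    _ = (kStar - ε) * M' * Real.sqrt (∫ x, ‖curl (u t') x‖ ^ 2) *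
          Real.sqrt (∫ x, frobeniusNormSq (fderiv ℝ (curl (u t')) x)) := by ring

/-! ## §4 W♭⁺ proved: the landed proof of W♭ (p719836, `…DepletedFraction.cleanLockedWindow_holds`) VERBATIM, exporting the pin
(identical to `Lines/budget_cut.lean` §5; repeated so that this workfile is self-contained) -/

/-- **W♭⁺ holds.**  Proof = the landed proof of `cleanLockedWindow_holds` (ns-net-p1 g15, p719836) with the single extra conjunct
`M = C√ν/√(T−τ)` discharged by `rfl` (the proof defines `M` so).  [folklore] -/
theorem cleanLockedWindowAtScale_holds : CleanLockedWindowAtScale := by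
  intro C ν T u p hV
  obtain ⟨hC, hν, hT, hsol, hLH, hdec, hrate, hsing, hno⟩ := hV
  have hsν : 0 < Real.sqrt ν := Real.sqrt_pos.2 hν
  have hC2 : 0 < C ^ 2 := by positivity
  -- the canonical coefficient: read-back and full upper log-density of efficient times
  obtain ⟨k, hkm, hk01, hcl, hkle, hread, hdens⟩ :=
    DepletionLadder.PerFlow.efficientTimes_logDensity_of_not_perFlow hν hT hsol hLH hdec hno
  -- locked late times have lower log-density `d₀`
  obtain ⟨c₂, d₀, hd₀, hS⟩ := DepletionLadder.PerFlow.lockedTimes_logDensity hC hν hT hsol hLH hdec hrate hsing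
  -- the Type-I onset and the gradient-rate onset
  obtain ⟨a₀, ha₀T, hsubI⟩ := mem_nhdsLT_iff_exists_Ioo_subset.1 hrate
  have ha₀T' : a₀ < T := ha₀T
  obtain ⟨C₁, hC₁, hgradev⟩ := DepletionLadder.PerFlow.gradTypeIRate_of_typeIRate hC hν hT hsol hLH hdec hrate
  obtain ⟨a₁, ha₁T, hsubG⟩ := mem_nhdsLT_iff_exists_Ioo_subset.1 hgradev
  have ha₁T' : a₁ < T := ha₁T
  -- the onset `t₀ ∈ [0,T)`, strictly past both onsets
  set t₀ : ℝ := max 0 ((max a₀ a₁ + T) / 2) with ht₀def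
  have hmaxT : max a₀ a₁ < T := max_lt ha₀T' ha₁T'
  have ht₀T : t₀ < T := max_lt hT (by linarith)
  have ht₀0 : 0 ≤ t₀ := le_max_left _ _
  have ha₀t₀ : a₀ < t₀ := lt_of_lt_of_le (by linarith [le_max_left a₀ a₁]) (le_max_right _ _)
  have ha₁t₀ : a₁ < t₀ := lt_of_lt_of_le (by linarith [le_max_right a₀ a₁]) (le_max_right _ _)
  -- Type-I and gradient bounds past `t₀`
  have hTypeI : ∀ s : ℝ, t₀ ≤ s → s < T → ∀ x, ‖u s x‖ ≤ C * Real.sqrt ν / Real.sqrt (T - s) := by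
    intro s h1 h2 x
    have hsq : 0 < Real.sqrt (T - s) := Real.sqrt_pos.2 (sub_pos.2 h2)
    rw [le_div_iff₀ hsq, mul_comm]
    exact hsubI ⟨ha₀t₀.trans_le h1, h2⟩ x
  have hGrad : ∀ s : ℝ, t₀ ≤ s → s < T → ∀ x, ‖fderiv ℝ (u s) x‖ ≤ C₁ / (T - s) := by
    intro s h1 h2 x
    have hTs : 0 < T - s := sub_pos.2 h2
    rw [le_div_iff₀ hTs, mul_comm]
    exact hsubG ⟨ha₁t₀.trans_le h1, h2⟩ x
  -- the constants
  refine ⟨k, max c₂ 1 * C ^ 2, C₁ / C ^ 2, 2, C ^ 2 / 2, hread, by positivity, by positivity, by norm_num,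
    by positivity, ?_⟩
  intro m hm_lo hm_lt η hη τ₁ hτ₁ hτ₁cw
  have hK : 0 < kStar := kStar_pos
  have hm0 : 0 ≤ m := by linarith
  -- the relative window length `a = τ₁/C² ∈ (0, 1/2]`
  set a : ℝ := τ₁ / C ^ 2 with hadef
  have ha : 0 < a := div_pos hτ₁ hC2
  have ha2 : a ≤ 1 / 2 := by
    rw [hadef, div_le_iff₀ hC2]
    linarith
  have ha1 : a < 1 := by linarith
  -- the efficient / inefficient sets
  have hEm : MeasurableSet {s : ℝ | m < k s} := measurableSet_lt measurable_const hkm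
  have hFm : MeasurableSet {σ : ℝ | k σ ≤ m} := measurableSet_le hkm measurable_const
  -- the locked set past `t₀`
  obtain ⟨S, hSmeas, hSsub, c, hSdens⟩ := hS t₀ ⟨ht₀0, ht₀T⟩
  -- the full-density instant `t`, with `δ = 1 − ηd₀/4`, `B = 1 + ηc/2`
  have hmK : m < kStar := hm_lt
  unfold kStar udcSet at hmK
  have hδ : 1 - η * d₀ / 4 < 1 := by
    have : 0 < η * d₀ / 4 := by positivity
    linarith
  obtain ⟨t, ht, hEt⟩ := hdens m hmK (1 - η * d₀ / 4) hδ (1 + η * c / 2) t₀ ⟨ht₀0, ht₀T⟩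
  have ht₀t : t₀ ≤ t := ht.1
  have htT : t < T := ht.2
  have hTt : 0 < T - t := sub_pos.2 htT
  have hlog0 : 0 ≤ Real.log ((T - t₀) / (T - t)) :=
    Real.log_nonneg ((one_le_div hTt).2 (by linarith))
  have hSt := hSdens t ht
  -- `Λ(F) = ℓ − Λ(E)`
  have hFE : (fun τ => ({σ : ℝ | k σ ≤ m} : Set ℝ).indicator (fun _ => (1 : ℝ)) τ / (T - τ)) =
      fun τ => 1 / (T - τ) - ({s : ℝ | m < k s} : Set ℝ).indicator (fun _ => (1 : ℝ)) τ / (T - τ) := by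
    funext τ
    by_cases h : m < k τ
    · have h1 : τ ∈ ({s : ℝ | m < k s} : Set ℝ) := h
      have h2 : τ ∉ ({σ : ℝ | k σ ≤ m} : Set ℝ) := fun h' => absurd h (not_lt.2 h')
      rw [indicator_of_mem h1, indicator_of_notMem h2]
      ring
    · have h1 : τ ∉ ({s : ℝ | m < k s} : Set ℝ) := h
      have h2 : τ ∈ ({σ : ℝ | k σ ≤ m} : Set ℝ) := not_lt.1 h
      rw [indicator_of_notMem h1, indicator_of_mem h2]
      ring
  have hΛF : ∫ τ in t₀..t, ({σ : ℝ | k σ ≤ m} : Set ℝ).indicator (fun _ => (1 : ℝ)) τ / (T - τ) =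
      Real.log ((T - t₀) / (T - t)) - ∫ τ in t₀..t, ({s : ℝ | m < k s} : Set ℝ).indicator (fun _ => (1 : ℝ)) τ / (T - τ) := by
    have hIone : IntervalIntegrable (fun τ => (1 : ℝ) / (T - τ)) volume t₀ t := by
      refine intervalIntegral.intervalIntegrable_one_div (fun τ hτ => ?_) (continuousOn_const.sub continuousOn_id)
      rw [Set.uIcc_of_le ht₀t] at hτ
      exact (sub_pos.2 (lt_of_le_of_lt hτ.2 htT)).ne'
    rw [hFE, intervalIntegral.integral_sub hIone (DepletionLadder.PerFlow.intervalIntegrable_indicator_div hEm ht₀t htT),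
      integral_one_div_sub_eq_log ht₀t htT]
  -- the Tonelli count gives a clean locked point in `S`
  have hbig : 2 * (∫ τ in t₀..t, ({σ : ℝ | k σ ≤ m} : Set ℝ).indicator (fun _ => (1 : ℝ)) τ / (T - τ)) + 2 <
      η * (∫ τ in t₀..t, S.indicator (fun _ => (1 : ℝ)) τ / (T - τ)) := by
    rw [hΛF]
    have h1 : η * (d₀ * Real.log ((T - t₀) / (T - t)) - c) ≤
        η * ∫ τ in t₀..t, S.indicator (fun _ => (1 : ℝ)) τ / (T - τ) := mul_le_mul_of_nonneg_left hSt hη.le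
    have h2 : 0 ≤ η * d₀ * Real.log ((T - t₀) / (T - t)) := by positivity
    nlinarith [h1, hEt, h2]
  obtain ⟨τ, hτS, hclean⟩ := exists_clean_point ht₀t htT hSmeas hFm ha ha2 hη hbig
  -- the package at `τ`
  obtain ⟨hτI, hlockτ⟩ := hSsub hτS
  have hτ0 : 0 ≤ τ := ht₀0.trans hτI.1
  have ht₀τ : t₀ ≤ τ := hτI.1
  have hτT : τ < T := hτI.2
  have hTτ : 0 < T - τ := sub_pos.2 hτT
  have hsqT : 0 < Real.sqrt (T - τ) := Real.sqrt_pos.2 hTτ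
  set M : ℝ := C * Real.sqrt ν / Real.sqrt (T - τ) with hMdef
  have hM : 0 < M := by positivity
  have hM2 : M ^ 2 = C ^ 2 * ν / (T - τ) := by
    rw [hMdef, div_pow, mul_pow, Real.sq_sqrt hν.le, Real.sq_sqrt hTτ.le]
  have hwin : τ₁ * ν / M ^ 2 = a * (T - τ) := by
    rw [hM2, hadef]
    field_simp
  have hνM : (ν / M) ^ 2 = ν * (T - τ) / C ^ 2 := by
    rw [div_pow, hM2]
    field_simp
  refine ⟨τ, M, hτ0, hM, ?_, rfl, fun x => hTypeI τ ht₀τ hτT x, ?_, ?_, ?_, ?_⟩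
  · -- the window ends before `T`
    rw [hwin]
    have ha' : a * (T - τ) ≤ 1 / 2 * (T - τ) := mul_le_mul_of_nonneg_right ha2 hTτ.le
    linarith only [ha', hTτ]
  · -- the Taylor lock `Z ≤ Θ (ν/M)² P`
    have hP0 : 0 ≤ ∫ x, frobeniusNormSq (fderiv ℝ (curl (u τ)) x) := integral_nonneg fun x => frobeniusNormSq_nonneg _
    have hνT : 0 ≤ ν * (T - τ) := by positivity
    calc (∫ x, ‖curl (u τ) x‖ ^ 2) ≤ c₂ * (ν * (T - τ)) * (∫ x, frobeniusNormSq (fderiv ℝ (curl (u τ)) x)) := hlockτ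
      _ ≤ max c₂ 1 * (ν * (T - τ)) * (∫ x, frobeniusNormSq (fderiv ℝ (curl (u τ)) x)) :=
          mul_le_mul_of_nonneg_right (mul_le_mul_of_nonneg_right (le_max_left _ _) hνT) hP0
      _ = max c₂ 1 * C ^ 2 * (ν / M) ^ 2 * (∫ x, frobeniusNormSq (fderiv ℝ (curl (u τ)) x)) := by
          rw [hνM]
          field_simp
  · -- the gradient bound `‖∇u(τ)‖ ≤ G M²/ν`
    intro x
    have h := hGrad τ ht₀τ hτT x
    have e : C₁ / C ^ 2 * M ^ 2 / ν = C₁ / (T - τ) := by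
      rw [hM2]
      field_simp
    rw [e]
    exact h
  · -- heights `≤ 2M` on the window
    intro t' ht' x
    rw [hwin] at ht'
    have ha' : a * (T - τ) ≤ 1 / 2 * (T - τ) := mul_le_mul_of_nonneg_right ha2 hTτ.le
    have ht'2 : t' ≤ τ + a * (T - τ) := ht'.2
    have ht'T : t' < T := by linarith only [ha', ht'2, hTτ]
    have hTt' : 0 < T - t' := sub_pos.2 ht'T
    have h4 : T - τ ≤ 4 * (T - t') := by linarith only [ha', ht'2, hTτ]
    have hb := hTypeI t' (ht₀τ.trans ht'.1) ht'T x
    have hsq : Real.sqrt (T - τ) ≤ 2 * Real.sqrt (T - t') := by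
      have h2 : Real.sqrt 4 = 2 := by
        rw [show (4 : ℝ) = 2 ^ 2 by norm_num, Real.sqrt_sq (by norm_num)]
      calc Real.sqrt (T - τ) ≤ Real.sqrt (4 * (T - t')) := Real.sqrt_le_sqrt h4
        _ = 2 * Real.sqrt (T - t') := by rw [Real.sqrt_mul (by norm_num), h2]
    have hsq' : 0 < Real.sqrt (T - t') := Real.sqrt_pos.2 hTt'
    have key : C * Real.sqrt ν / Real.sqrt (T - t') ≤ 2 * M := by
      rw [hMdef, div_le_iff₀ hsq',
        show 2 * (C * Real.sqrt ν / Real.sqrt (T - τ)) * Real.sqrt (T - t') =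
          C * Real.sqrt ν * (2 * Real.sqrt (T - t')) / Real.sqrt (T - τ) by ring,
        le_div_iff₀ hsqT]
      exact mul_le_mul_of_nonneg_left hsq (mul_pos hC hsν).le
    exact hb.trans key
  · -- cleanliness
    rw [hwin]
    exact hclean

/-! ## §5 THE SKELETON: D♭ + R♭ ⇒ the crux BY NAME (R♭ proved in §1b, W♭⁺ in §4; the only `sorry` is D♭) -/

/-- **pinned X♭ per violator ⇒ the crux** — the g12-β measure sandwich, run with W♭⁺ (`cleanLockedWindowAtScale_holds`, §5): violator
frame → W♭⁺'s constants `k, Θ, G, H, c_w` → `ε` (may depend on the violator) → level `m = κ⋆ − min(ε, κ⋆/2)`, cleanliness `ε/2` → W♭⁺'s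
PINNED window at `τ` → `ε|I| ≤ |DEPLETED ∩ I| ≤ |{k ≤ m} ∩ I| ≤ (ε/2)|I|` with `|I| = c_w ν/M² > 0`: absurd. -/
theorem nearExtremalTransiencePerFlow_of_pinned (hX : PinnedDepletedFraction) : NearExtremalTransiencePerFlow := by
  have hW := cleanLockedWindowAtScale_holds
  intro C ν T hC hν hT u p hsol hLH hdec hrate hsing
  by_contra hno
  have hV : IsViolator C ν T u p := ⟨hC, hν, hT, hsol, hLH, hdec, hrate, hsing, hno⟩
  obtain ⟨k, Θ, G, H, c_w, hkeff, hΘ, hGpos, hH, hcw, hwin⟩ := hW C ν T u p hV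
  -- X♭'s fraction `ε` for THIS violator at window length `τ₁ = c_w`
  obtain ⟨ε, hε, hX1⟩ := hX C ν T u p hV Θ G H c_w hΘ hGpos hH hcw
  have hK : 0 < kStar := kStar_pos
  obtain ⟨e, hedef⟩ : ∃ e : ℝ, e = min ε (kStar / 2) := ⟨_, rfl⟩
  have hepos : 0 < e := by rw [hedef]; exact lt_min hε (by linarith)
  have heε : e ≤ ε := by rw [hedef]; exact min_le_left _ _
  have heK : e ≤ kStar / 2 := by rw [hedef]; exact min_le_right _ _
  obtain ⟨m, hmdef⟩ : ∃ m : ℝ, m = kStar - e := ⟨_, rfl⟩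
  have hm_lo : kStar / 2 ≤ m := by linarith
  have hm_lt : m < kStar := by linarith
  have hm0 : 0 ≤ m := by linarith
  have hmε : kStar - ε ≤ m := by linarith
  have hη : 0 < ε / 2 := by linarith
  obtain ⟨τ, M, hτ0, hM0, hτT, hpin, hMb, hlock, hgrad, hheights, hclean⟩ :=
    hwin m hm_lo hm_lt (ε / 2) hη c_w hcw le_rfl
  have hfrac := hX1 τ M hτ0 hM0 hτT hpin hMb hlock hgrad hheights
  -- read-back: a depleted time of the window is an inefficient time (`k ≤ m`)
  have hsub : ({t' : ℝ | ∀ M' : ℝ, (∀ x, ‖u t' x‖ ≤ M') →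
        |∫ x, ⟪curl (u t') x, fderiv ℝ (u t') x (curl (u t') x)⟫_ℝ| ≤
          (kStar - ε) * M' * Real.sqrt (∫ x, ‖curl (u t') x‖ ^ 2) *
            Real.sqrt (∫ x, frobeniusNormSq (fderiv ℝ (curl (u t')) x))} ∩
        Set.Icc τ (τ + c_w * ν / M ^ 2)) ⊆
      ({σ : ℝ | k σ ≤ m} ∩ Set.Icc τ (τ + c_w * ν / M ^ 2)) := by
    rintro t' ⟨hdep, ht'I⟩
    refine ⟨?_, ht'I⟩
    have ht'0 : 0 ≤ t' := hτ0.trans ht'I.1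
    have ht'T : t' < T := lt_of_le_of_lt ht'I.2 hτT
    show k t' ≤ m
    by_contra hlt
    push Not at hlt
    obtain ⟨M', hM', hstr⟩ := hkeff t' ⟨ht'0, ht'T⟩ m hm0 hlt
    have hM'0 : 0 ≤ M' := (norm_nonneg _).trans (hM' 0)
    have hle := hdep M' hM'
    have hP' : 0 ≤ M' * Real.sqrt (∫ x, ‖curl (u t') x‖ ^ 2) *
        Real.sqrt (∫ x, frobeniusNormSq (fderiv ℝ (curl (u t')) x)) := by positivity
    have hmono : (kStar - ε) * M' * Real.sqrt (∫ x, ‖curl (u t') x‖ ^ 2) *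
        Real.sqrt (∫ x, frobeniusNormSq (fderiv ℝ (curl (u t')) x)) ≤
        m * M' * Real.sqrt (∫ x, ‖curl (u t') x‖ ^ 2) *
        Real.sqrt (∫ x, frobeniusNormSq (fderiv ℝ (curl (u t')) x)) := by
      have h := mul_le_mul_of_nonneg_right hmε hP'
      calc (kStar - ε) * M' * Real.sqrt (∫ x, ‖curl (u t') x‖ ^ 2) *
            Real.sqrt (∫ x, frobeniusNormSq (fderiv ℝ (curl (u t')) x))
          = (kStar - ε) * (M' * Real.sqrt (∫ x, ‖curl (u t') x‖ ^ 2) *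
            Real.sqrt (∫ x, frobeniusNormSq (fderiv ℝ (curl (u t')) x))) := by ring
        _ ≤ m * (M' * Real.sqrt (∫ x, ‖curl (u t') x‖ ^ 2) *
            Real.sqrt (∫ x, frobeniusNormSq (fderiv ℝ (curl (u t')) x))) := h
        _ = m * M' * Real.sqrt (∫ x, ‖curl (u t') x‖ ^ 2) *
            Real.sqrt (∫ x, frobeniusNormSq (fderiv ℝ (curl (u t')) x)) := by ring
    exact absurd (lt_of_lt_of_le hstr (hle.trans hmono)) (lt_irrefl _)
  have hcmp : ENNReal.ofReal (ε * (c_w * ν / M ^ 2)) ≤ ENNReal.ofReal (ε / 2 * (c_w * ν / M ^ 2)) :=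
    (hfrac.trans (measure_mono hsub)).trans hclean
  have hI : 0 < c_w * ν / M ^ 2 := by positivity
  have hrhs : 0 ≤ ε / 2 * (c_w * ν / M ^ 2) := by positivity
  have hreal : ε * (c_w * ν / M ^ 2) ≤ ε / 2 * (c_w * ν / M ^ 2) := (ENNReal.ofReal_le_ofReal_iff hrhs).1 hcmp
  nlinarith [hreal, hI, hε]

/-- **LINE g13-β SKELETON** — the ONE theorem concluding the crux BY NAME from exactly the two registered stubs:
R♭ (relay obstruction, flank) and D♭ (cell relay decomposition, heart).  [folklore] -/
theorem NearExtremalTransiencePerFlow_of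
    (hR : Registered.stub_relayObstruction) (hD : Registered.stub_cellRelayDecomposition) :
    NearExtremalTransiencePerFlow :=
  nearExtremalTransiencePerFlow_of_pinned (pinnedDepletedFraction_of_relay hR hD)

/-- **THE LINE, heart only.**  Since R♭ is proved in §1b, the crux follows from the ONE open stub D♭. [folklore] -/
theorem NearExtremalTransiencePerFlow_of_heart (hD : Registered.stub_cellRelayDecomposition) :
    NearExtremalTransiencePerFlow :=
  NearExtremalTransiencePerFlow_of relayObstruction_holds hD

end Summit.NavierStokesRegularity.NavierStokesRegularity.Cruxes.NearExtremalTransiencePerFlow.Relay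

end
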